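import Summits.ResolutionOfSingularities.ResolutionOfSingularities.Theorems.LatencyCutCells
import Summits.ResolutionOfSingularities.ResolutionOfSingularities.Theorems.MaxContactCutTameCut
import HarnessLib

/-!
# MaxContactCutLatencyCut — decomp-res node «LatencyCut» (lens-4 g22) refining the MaxContactCut asides 28054 /
32260; tree file 5/5 of the node

Content VERBATIM from the decomp-res lens-4 g22 file `HOME/decomp-res-lens-4/g22/LatencyCut.lean` (sha256 6bd4fa7be8c896a2,
940 l, written directly against the tree on top of the landed g21 node «TameCut» = `Theorems/TameCutClasses`,
`TameCutKernels`,
`MaxContactCutTameCut`).  HOME = run/shared/lean/pub/decomp-res.  Critic: CRITIC-LEDGER row 137 CLEARED, landing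
order 2026-08-30T19:54:01Z.

Inside the Theses cone: §52 BY NAME — `noLatentOffLocusTowers_of_item` /
`noLatentNonPrincipalInLocusTowers_of_item` (GIVEN 31571
`MaxContactCut.NoContactHuggingTowers`), EXACT `noOffLocusShadowTowers_iff_g22` /
`noNonPrincipalInLocusTowers_iff_g22` / `noWildOffLocusTowers_iff_g22`,
the booked aside 28054 re-located EXACTLY: `tcNoWildOffLocusTowers_iff_g22` (GIVEN 31571) / `tcNoWildOffLocusTowers_of_g22` /
`noWildContactFreeOffLocusTowers_of_item` (28054 ⇒ the new residual, hypothesis-free),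
`noWildHuggingTowers_iff_g22` (NO hypothesis), the root / host:
`noForcedTowers_of_g22` / `_iff_g22`, `noSingularSurfaceHuggingTowers_of_g22` / `_iff_g22` / `_iff_g22_beds` /
`_iff_g22'`, up-links
`noSurfaceHuggingTowers_of_g22`, `noHuggingTowers_of_g22`; plus the two port-conditional theorems of §50/§51
(`noTowerPerfect_latent_of_ports`,
`latentPerfectOffLocus_of_ports`, via the tree's `MaxContactCutContactShadow.contactPerfect_of_ports`).

[WRITER NOTE (decomp-res writer g7): namespace `…Theorems.HugValuationCut` as the whole lens-4 chain; split by the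
critic's order into
`TameCutStage` (§48), `LatencyCutKernels` (§49 + §53), `LatencyCutClasses` (§50) + `LatencyCutCells` (§51 + the
§52 all-weights CLASSES; the
critic's single `LatencyCutClasses` exceeds the 400-line file limit, hence two files), all four route-independent
(OUTSIDE the Theses cone,
importing only the cone-free `TameCutKernels` instead of the lens's `MaxContactCutTameCut`), and
`MaxContactCutLatencyCut` (inside the cone:
the §52 BY-NAME theorems + the two port-conditional theorems `noTowerPerfect_latent_of_ports` (§50) /
`latentPerfectOffLocus_of_ports` (§51),
whose binder `MaxContactCut.MarkedThreefoldResolution` is a route decl).  `section StageKernel` re-opened in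
`LatencyCutKernels`; the global
`set_option linter.dupNamespace false` dropped; the lens's consistency restatement
`contactHugging_of_isAbsContactAt_root'` (≡ the landed
`TameCutKernels.contactHugging_of_isAbsContactAt_root`, dedup.landed) deleted; nothing else changed.]

(Sources: Giraud1975; EncinasVillamayor2000 Thm. 4.9; BravoGarciaEscamillaVillamayor2012 Lemma 4.6; EGAIV4 Thm.
16.11.2; CossartPiltant2008 Prop. 4.2; BierstoneGrigorievMilmanWlodarczyk2011 Lemma 3.4; GortzWedhorn2020 Prop.
13.96; Liu2002 Thm. 8.1.19; Matsumura1987 Thm. 15.5, Thm. 30.5; CossartJannsenSaito2020; CossartPiltant2019;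
Hironaka1964; Moh1987; Cutkosky2009 Thm. 5.1.)
-/

noncomputable section

open CategoryTheory AlgebraicGeometry IsLocalRing
open Literature.AlgebraicGeometry.Resolution
open Summit.ResolutionOfSingularities.ResolutionOfSingularities.Theses
open Summit.ResolutionOfSingularities.ResolutionOfSingularities.Theorems
open WeakOrderReduction ForcedTowerClasses DivergentTowerClasses MonomialTowerClasses
open HugDimensionClasses HugDimensionKernels SurfaceShadowClasses SurfaceShadowKernels
open ContactShadowClasses (NoTowerImperfect ContactShadow TowerObstructsAll ContactPerfect)
open ContactShadowKernels (noTowerImperfect_of_noTower noTowerImperfect_mono noTower_iff_columns)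
open NearPointCut (SingularClass singularSurface_iff_noTower)
open AbsoluteContactClasses (IsAbsContactAt SepResidueAt AbsInv absInv_point hsPortSepResidue sepResidueAt_of_perfectField not_perfectField_of_not_sepResidueAt diffIdeal_restrict_le)

namespace Summit.ResolutionOfSingularities.ResolutionOfSingularities.Theorems.HugValuationCut

/-! ## §50 (g22) — the port-conditional latent perfect bed -/

/-- **The perfect latent column of every class is EMPTY modulo the tree's g12 ports** (`ContactShadow`,
`TowerObstructsAll`) and X1 28616 BY NAME (scope = the critic's row-76 booking verbatim: «X1 28616 KNOWN-MOD-PORT(perfect) BY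
NAME c := n!»). [folklore] -/
theorem noTowerPerfect_latent_of_ports {n : ℕ} (hn : 1 ≤ n) {P : ForcedTower → Prop} (hS : ContactShadow n)
    (hO : TowerObstructsAll) (hX : MaxContactCut.MarkedThreefoldResolution) :
    NoTowerPerfect n fun T => P T ∧ LatentContact n T :=
  noTowerPerfect_latent_of_contactPerfect hn (MaxContactCutContactShadow.contactPerfect_of_ports hS hO hX)

/-! ## §51 (g22) — the port-conditional latent perfect off-locus cell -/

/-- **(O, latent) over a PERFECT field is EMPTY modulo the tree's g12 ports and X1 28616 BY NAME.** [folklore] -/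
theorem latentPerfectOffLocus_of_ports {n : ℕ} (hn : 1 ≤ n) (hS : ContactShadow n) (hO : TowerObstructsAll)
    (hX : MaxContactCut.MarkedThreefoldResolution) :
    NoTowerPerfect n fun T => (SingularClass T ∧ Nonempty (MarkedShadow T n)) ∧ LatentContact n T :=
  noTowerPerfect_latent_of_ports hn hS hO hX

/-! ## §52 (g22 · NEW) Up to the booked MaxContactCut items BY NAME — all weights (classes in `LatencyCutCells`) -/

/-- **(O, latent) over all weights from 31571 BY NAME** (no port). [folklore] -/
theorem noLatentOffLocusTowers_of_item (h : MaxContactCut.NoContactHuggingTowers) : NoLatentOffLocusTowers :=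
  fun n hn => latentOffLocus_of_contact hn (h n hn)

/-- **(L,¬P, latent) over all weights from 31571 BY NAME** (no port). [folklore] -/
theorem noLatentNonPrincipalInLocusTowers_of_item (h : MaxContactCut.NoContactHuggingTowers) :
    NoLatentNonPrincipalInLocusTowers :=
  fun n hn => latentNonPrincipal_of_contact hn (h n hn)

/-- **EXACT over all weights GIVEN 31571: `(O) ⟺ (O, contact-free)`.** [folklore] -/
theorem noOffLocusShadowTowers_iff_g22 (h71 : MaxContactCut.NoContactHuggingTowers) :
    NoOffLocusShadowTowers ↔ NoContactFreeOffLocusTowers :=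
  ⟨fun h n hn => (offLocus_iff_g22 hn (h71 n hn)).mp (h n hn), fun h n hn => (offLocus_iff_g22 hn (h71 n hn)).mpr (h n hn)⟩

/-- **EXACT over all weights GIVEN 31571: `(L,¬P) ⟺ (L,¬P, contact-free)`.** [folklore] -/
theorem noNonPrincipalInLocusTowers_iff_g22 (h71 : MaxContactCut.NoContactHuggingTowers) :
    NoNonPrincipalInLocusTowers ↔ NoContactFreeNonPrincipalInLocusTowers :=
  ⟨fun h n hn => (nonPrincipal_iff_g22 hn (h71 n hn)).mp (h n hn),
    fun h n hn => (nonPrincipal_iff_g22 hn (h71 n hn)).mpr (h n hn)⟩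

/-- **EXACT RE-LOCATION OF g21's `NoWildOffLocusTowers` over all weights GIVEN 31571:
`NoWildOffLocusTowers ⟺ NoWildContactFreeOffLocusTowers`.** [folklore] -/
theorem noWildOffLocusTowers_iff_g22 (h71 : MaxContactCut.NoContactHuggingTowers) :
    NoWildOffLocusTowers ↔ NoWildContactFreeOffLocusTowers :=
  ⟨fun h n hn => (wildOffLocus_iff_g22 hn (h71 n hn)).mp (h n hn),
    fun h n hn => (wildOffLocus_iff_g22 hn (h71 n hn)).mpr (h n hn)⟩

/-- **THE BOOKED ASIDE 28054 `MaxContactCut.TCNoWildOffLocusTowers` EXACTLY RE-LOCATED GIVEN 31571: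
`TCNoWildOffLocusTowers ⟺ NoWildContactFreeOffLocusTowers`** (its latent sub-cell is ⊆ 31571 by kernel). [folklore] -/
theorem tcNoWildOffLocusTowers_iff_g22 (h71 : MaxContactCut.NoContactHuggingTowers) :
    MaxContactCut.TCNoWildOffLocusTowers ↔ NoWildContactFreeOffLocusTowers :=
  (Iff.rfl : MaxContactCut.TCNoWildOffLocusTowers ↔ NoWildOffLocusTowers).trans (noWildOffLocusTowers_iff_g22 h71)

/-- **28054 BY NAME from its located residual and 31571.** [folklore] -/
theorem tcNoWildOffLocusTowers_of_g22 (h71 : MaxContactCut.NoContactHuggingTowers) (h : NoWildContactFreeOffLocusTowers) :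
    MaxContactCut.TCNoWildOffLocusTowers :=
  (tcNoWildOffLocusTowers_iff_g22 h71).mpr h

/-- the located residual is WEAKER than 28054 by letter (no hypothesis). [folklore] -/
theorem noWildContactFreeOffLocusTowers_of_item (h : MaxContactCut.TCNoWildOffLocusTowers) :
    NoWildContactFreeOffLocusTowers :=
  fun n hn => wildContactFreeOffLocus_of_wildOffLocus (h n hn)

/-- **the DECIDED sub-cell of 28054 over all weights from 31571 BY NAME** (no port). [folklore] -/
theorem noWildLatentOffLocusTowers_of_item (h71 : MaxContactCut.NoContactHuggingTowers) :
    ∀ n : ℕ, 1 ≤ n → WildLatentOffLocusTowersTerminate n :=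
  fun n hn => wildLatentOffLocus_of_contact hn (h71 n hn)

/-- **EXACT RE-LOCATION of g21's `NoTameInsepOffLocusTowers` over all weights GIVEN 31571.** [folklore] -/
theorem noTameInsepOffLocusTowers_iff_g22 (h71 : MaxContactCut.NoContactHuggingTowers) :
    NoTameInsepOffLocusTowers ↔ NoTameInsepContactFreeOffLocusTowers :=
  ⟨fun h n hn => (tameInsepOffLocus_iff_g22 hn (h71 n hn)).mp (h n hn),
    fun h n hn => (tameInsepOffLocus_iff_g22 hn (h71 n hn)).mpr (h n hn)⟩

/-- **EXACT, hypothesis-free, over all weights: 31572 `MaxContactCut.NoWildHuggingTowers ⟺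
NoContactFreeWildHuggingTowers`.** [folklore] -/
theorem noWildHuggingTowers_iff_g22 : MaxContactCut.NoWildHuggingTowers ↔ NoContactFreeWildHuggingTowers :=
  ⟨fun h n hn => (wildHugging_iff_g22 hn).mp (h n hn), fun h n hn => (wildHugging_iff_g22 hn).mpr (h n hn)⟩

/-- **30253 `MaxContactCut.NoForcedTowers` BY NAME from the g22 cells, 31571 and the ports.** [folklore] -/
theorem noForcedTowers_of_g22 (hMo : MaxContactCut.MonomialCornerAll) (hC : MaxContactCut.CurveLawAll)
    (hSL : MaxContactCut.SurfaceLawAll) (hH : MaxContactCut.NoHypersurfaceHuggingTowers) (hP : ShadowPortAll)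
    (hM : MarkingPortAll) (hDesc : DescentPortAll) (hFC : FactorContactPortAll) (hCo : CouplingPortAll)
    (hRi : RiderPortAll) (h71 : MaxContactCut.NoContactHuggingTowers) (hO : NoContactFreeOffLocusTowers)
    (hNP : NoContactFreeNonPrincipalInLocusTowers) (hPu : NoPurePrincipalTowers)
    (hR : NoIncommensurableWildDriftingImperfectTowers) : MaxContactCut.NoForcedTowers :=
  noForcedTowers_of_g19 hMo hC hSL hH hP hM hDesc hFC hCo hRi ((noOffLocusShadowTowers_iff_g22 h71).mpr hO)
    ((noNonPrincipalInLocusTowers_iff_g22 h71).mpr hNP) hPu hR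

/-- **EXACT AT THE ROOT 30253 (g19's hypothesis list EXACTLY; 31571 as a booked conjunct):
`NoForcedTowers ⟺ 31571 ∧ (O, cf) ∧ (L,¬P, cf) ∧ (L,P,pure) ∧ (imperfect residual)`.** [folklore] -/
theorem noForcedTowers_iff_g22 (hMo : MaxContactCut.MonomialCornerAll) (hC : MaxContactCut.CurveLawAll)
    (hSL : MaxContactCut.SurfaceLawAll) (hH : MaxContactCut.NoHypersurfaceHuggingTowers) (hP : ShadowPortAll)
    (hM : MarkingPortAll) (hDesc : DescentPortAll) (hFC : FactorContactPortAll) (hCo : CouplingPortAll)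
    (hRi : RiderPortAll) :
    MaxContactCut.NoForcedTowers ↔
      MaxContactCut.NoContactHuggingTowers ∧ NoContactFreeOffLocusTowers ∧ NoContactFreeNonPrincipalInLocusTowers ∧
        NoPurePrincipalTowers ∧ NoIncommensurableWildDriftingImperfectTowers := by
  refine ⟨fun h => ?_, fun h => noForcedTowers_of_g22 hMo hC hSL hH hP hM hDesc hFC hCo hRi h.1 h.2.1 h.2.2.1 h.2.2.2.1
    h.2.2.2.2⟩
  have h19 := (noForcedTowers_iff_g19 hMo hC hSL hH hP hM hDesc hFC hCo hRi).mp h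
  have h71 := noContactHuggingTowers_of_noForcedTowers h
  exact ⟨h71, (noOffLocusShadowTowers_iff_g22 h71).mp h19.1, (noNonPrincipalInLocusTowers_iff_g22 h71).mp h19.2.1,
    h19.2.2.1, h19.2.2.2⟩

/-- **THE HOST 32260 `MaxContactCut.NoSingularSurfaceHuggingTowers` BY NAME from the g22 cells, 31571 and the
ports.** [folklore] -/
theorem noSingularSurfaceHuggingTowers_of_g22 (hMo : MaxContactCut.MonomialCornerAll) (hC : MaxContactCut.CurveLawAll)
    (hSL : MaxContactCut.SurfaceLawAll) (hH : MaxContactCut.NoHypersurfaceHuggingTowers) (hP : ShadowPortAll)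
    (hM : MarkingPortAll) (hDesc : DescentPortAll) (hFC : FactorContactPortAll) (hCo : CouplingPortAll)
    (hRi : RiderPortAll) (h71 : MaxContactCut.NoContactHuggingTowers) (hO : NoContactFreeOffLocusTowers)
    (hNP : NoContactFreeNonPrincipalInLocusTowers) (hPu : NoPurePrincipalTowers)
    (hR : NoIncommensurableWildDriftingImperfectTowers) : MaxContactCut.NoSingularSurfaceHuggingTowers :=
  noSingularSurfaceHuggingTowers_of_g19 hMo hC hSL hH hP hM hDesc hFC hCo hRi
    ((noOffLocusShadowTowers_iff_g22 h71).mpr hO) ((noNonPrincipalInLocusTowers_iff_g22 h71).mpr hNP) hPu hR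

/-- **EXACT AT THE HOST 32260 GIVEN 31571 (tree g19 ports):
`32260 ⟺ (O, cf) ∧ (L,¬P, cf) ∧ (L,P,pure) ∧ (imperfect residual)`.** [folklore] -/
theorem noSingularSurfaceHuggingTowers_iff_g22 (hMo : MaxContactCut.MonomialCornerAll) (hC : MaxContactCut.CurveLawAll)
    (hSL : MaxContactCut.SurfaceLawAll) (hH : MaxContactCut.NoHypersurfaceHuggingTowers) (hP : ShadowPortAll)
    (hM : MarkingPortAll) (hDesc : DescentPortAll) (hFC : FactorContactPortAll) (hCo : CouplingPortAll)
    (hRi : RiderPortAll) (h71 : MaxContactCut.NoContactHuggingTowers) :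
    MaxContactCut.NoSingularSurfaceHuggingTowers ↔
      NoContactFreeOffLocusTowers ∧ NoContactFreeNonPrincipalInLocusTowers ∧ NoPurePrincipalTowers ∧
        NoIncommensurableWildDriftingImperfectTowers := by
  rw [noSingularSurfaceHuggingTowers_iff_g19 hMo hC hSL hH hP hM hDesc hFC hCo hRi, noOffLocusShadowTowers_iff_g22 h71,
    noNonPrincipalInLocusTowers_iff_g22 h71]

/-- **EXACT AT THE HOST 32260 GIVEN 31571, read on g21's axis:
`32260 ⟺ (O,wild,cf) ∧ (O,tame–insep,cf) ∧ (L,¬P,wild,cf) ∧ (L,¬P,tame–insep,cf) ∧ (L,P,pure) ∧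
(imperfect residual)`.** [folklore] -/
theorem noSingularSurfaceHuggingTowers_iff_g22_beds (hMo : MaxContactCut.MonomialCornerAll)
    (hC : MaxContactCut.CurveLawAll) (hSL : MaxContactCut.SurfaceLawAll) (hH : MaxContactCut.NoHypersurfaceHuggingTowers)
    (hP : ShadowPortAll) (hM : MarkingPortAll) (hDesc : DescentPortAll) (hFC : FactorContactPortAll)
    (hCo : CouplingPortAll) (hRi : RiderPortAll) (h71 : MaxContactCut.NoContactHuggingTowers) :
    MaxContactCut.NoSingularSurfaceHuggingTowers ↔
      NoWildContactFreeOffLocusTowers ∧ NoTameInsepContactFreeOffLocusTowers ∧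
        NoWildContactFreeNonPrincipalInLocusTowers ∧ NoTameInsepContactFreeNonPrincipalInLocusTowers ∧
          NoPurePrincipalTowers ∧ NoIncommensurableWildDriftingImperfectTowers := by
  rw [noSingularSurfaceHuggingTowers_iff_g22 hMo hC hSL hH hP hM hDesc hFC hCo hRi h71, noContactFreeOffLocusTowers_iff_beds,
    noContactFreeNonPrincipalInLocusTowers_iff_beds]
  simp only [and_assoc]

/-- **EXACT AT THE HOST 32260 with g19's hypothesis list EXACTLY** — the latent cells kept as explicit conjuncts
(certified `⊆ 31571` by `noLatentOffLocusTowers_of_item` / `noLatentNonPrincipalInLocusTowers_of_item`). [folklore] -/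
theorem noSingularSurfaceHuggingTowers_iff_g22' (hMo : MaxContactCut.MonomialCornerAll) (hC : MaxContactCut.CurveLawAll)
    (hSL : MaxContactCut.SurfaceLawAll) (hH : MaxContactCut.NoHypersurfaceHuggingTowers) (hP : ShadowPortAll)
    (hM : MarkingPortAll) (hDesc : DescentPortAll) (hFC : FactorContactPortAll) (hCo : CouplingPortAll)
    (hRi : RiderPortAll) :
    MaxContactCut.NoSingularSurfaceHuggingTowers ↔
      (NoLatentOffLocusTowers ∧ NoLatentNonPrincipalInLocusTowers) ∧ NoContactFreeOffLocusTowers ∧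
        NoContactFreeNonPrincipalInLocusTowers ∧ NoPurePrincipalTowers ∧ NoIncommensurableWildDriftingImperfectTowers := by
  rw [noSingularSurfaceHuggingTowers_iff_g19 hMo hC hSL hH hP hM hDesc hFC hCo hRi]
  constructor
  · rintro ⟨hO, hNP, hPu, hR⟩
    exact ⟨⟨fun n hn => (offLocus_iff_cells_g22.mp (hO n hn)).1, fun n hn => (nonPrincipal_iff_cells_g22.mp (hNP n hn)).1⟩,
      fun n hn => (offLocus_iff_cells_g22.mp (hO n hn)).2, fun n hn => (nonPrincipal_iff_cells_g22.mp (hNP n hn)).2, hPu, hR⟩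
  · rintro ⟨⟨hLO, hLN⟩, hO, hNP, hPu, hR⟩
    exact ⟨fun n hn => offLocus_iff_cells_g22.mpr ⟨hLO n hn, hO n hn⟩,
      fun n hn => nonPrincipal_iff_cells_g22.mpr ⟨hLN n hn, hNP n hn⟩, hPu, hR⟩

/-- 32203 `MaxContactCut.NoSurfaceHuggingTowers` BY NAME (up-link). [folklore] -/
theorem noSurfaceHuggingTowers_of_g22 (hMo : MaxContactCut.MonomialCornerAll) (hC : MaxContactCut.CurveLawAll)
    (hSL : MaxContactCut.SurfaceLawAll) (hH : MaxContactCut.NoHypersurfaceHuggingTowers) (hP : ShadowPortAll)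
    (hM : MarkingPortAll) (hDesc : DescentPortAll) (hFC : FactorContactPortAll) (hCo : CouplingPortAll)
    (hRi : RiderPortAll) (h71 : MaxContactCut.NoContactHuggingTowers) (hO : NoContactFreeOffLocusTowers)
    (hNP : NoContactFreeNonPrincipalInLocusTowers) (hPu : NoPurePrincipalTowers)
    (hR : NoIncommensurableWildDriftingImperfectTowers) : MaxContactCut.NoSurfaceHuggingTowers :=
  noSurfaceHuggingTowers_of_g19 hMo hC hSL hH hP hM hDesc hFC hCo hRi ((noOffLocusShadowTowers_iff_g22 h71).mpr hO)
    ((noNonPrincipalInLocusTowers_iff_g22 h71).mpr hNP) hPu hR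

/-- 31570 `MaxContactCut.NoHuggingTowers` BY NAME (up-link). [folklore] -/
theorem noHuggingTowers_of_g22 (hMo : MaxContactCut.MonomialCornerAll) (hC : MaxContactCut.CurveLawAll)
    (hSL : MaxContactCut.SurfaceLawAll) (hH : MaxContactCut.NoHypersurfaceHuggingTowers) (hP : ShadowPortAll)
    (hM : MarkingPortAll) (hDesc : DescentPortAll) (hFC : FactorContactPortAll) (hCo : CouplingPortAll)
    (hRi : RiderPortAll) (h71 : MaxContactCut.NoContactHuggingTowers) (hO : NoContactFreeOffLocusTowers)
    (hNP : NoContactFreeNonPrincipalInLocusTowers) (hPu : NoPurePrincipalTowers)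
    (hR : NoIncommensurableWildDriftingImperfectTowers) : MaxContactCut.NoHuggingTowers :=
  noHuggingTowers_of_g19 hMo hC hSL hH hP hM hDesc hFC hCo hRi ((noOffLocusShadowTowers_iff_g22 h71).mpr hO)
    ((noNonPrincipalInLocusTowers_iff_g22 h71).mpr hNP) hPu hR

end Summit.ResolutionOfSingularities.ResolutionOfSingularities.Theorems.HugValuationCut
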